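import Literature.AnabelianGeometry.SemiGraphs.LevelBranchDiagonal
import Literature.AnabelianGeometry.SemiGraphs.CoveringHomCanBranchAligned
import Literature.AnabelianGeometry.SemiGraphs.BranchSubgroupFrames
import Literature.AnabelianGeometry.SemiGraphs.CommensurableTerminalityLemmas
import HarnessLib

/-!
# Level branch groups of the covering `𝒢_A → 𝒢` in `Π_𝒢`-coordinates: the dictionary with its pinning ([SemiAnbd] §2)

Mochizuki, *Semi-graphs of anabelioids*, Publ. RIMS **42** (2006) 221–322, §2, Definition 2.2 (i)
p. 23 ("the edges of `𝔾′` that lie over an edge `e` correspond to the connected components of `T_e`")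
and Remark 2.2.1 p. 24 ("the image of each `Π_v` (respectively, `Π_b`) in `Π_𝒢` is equal to the
stabilizer of a compatible system of vertices (respectively, edges) of this pro-semi-graph")
[cite: MochizukiSemiAnbd2006, Rem. 2.2.1 p.24].

PROOF-ONLY file (abc-iut cell, layer L3, row F-1477 / [SemiAnbd] Rmk. 2.10.1 `remark_2_10_1`,
sub-node (L4b-dict); seat abc-iut-w5-d186, holder/assembler abc-iut-L3-t12, co-worker abc-iut-L6-t18
(`LevelEdgesOfObject`, `LevelEdgesLoops`, `LevelEdgesStabilizers`)).  For the covering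
`φ : 𝒢_A → 𝒢` attached to `A ∈ B(𝒢)` (`BObj.coveringHom`, canonical twin `BObj.coveringHomCan`), a base
level vertex `ṽ₁ = (v, P₁)` with basepoints `F′` of `(𝒢_v)_{P₁}`, `F` of `𝒢_v` and `e : φ_{ṽ₁}^* ⋙ F′ ≅ F`
(so `ι = Aut(ρ_v ◁ e) ∘ π₁(φ^*) : Π_{𝒢_A} → Π_𝒢`, as in (D1) `covering_decompositionGroup`), and a level
branch `b̃ = (b, Q)` abutting to a level vertex `ṽ = (v, P)` over the same `v`, with ANY basepoints
`F″` of `(𝒢_v)_P`, `F_Q` of `(𝒢_e)_Q`, transports `α̃ : b̃^* ⋙ F_Q ≅ F″`, `α : ρ̃_ṽ ⋙ F″ ≅ ρ̃_{ṽ₁} ⋙ F′`: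

* `BObj.coveringHom_levelBranch_dictionary` — the branch group `Π_{b̃}`, carried into
  `Π_{𝒢_A}` (through `Π_ṽ` and `α`) and then into `Π_𝒢` by `ι`, is
  `Stab_{Π_𝒢}(x₀) ∩ γ Π_b γ⁻¹` for an element `γ ∈ Π_𝒢` WITH `y(γ⁻¹ · x₀) ∈ F_e(Q)` — where `x₀ ∈ F(S_v)` is
  the tautological base point of `ι` (`range_ι_le_stabilizer`: `ι(Π_{𝒢_A}) ≤ Stab(x₀)`),
  `Π_b = Π_b^{F_e, α_e} ⊆ Π_𝒢` is the branch group for a reference edge basepoint `F_e` with transport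
  `α_e : b^* ⋙ F_e ≅ F`, and `y(x) = F_e(ψ_b)(α_e⁻¹ x) ∈ F_e(T_e)` names the level edge through a point
  (abc-iut-L6-t18's `LevelEdgesOfObject`).  The second clause is the PINNING: the conjugating element
  is tied to the level branch `(b, Q)` — the labelling which the pure-group dictionary (D2)/(Dbr)
  deliberately omits; it is what [SemiAnbd] Rmk. 2.10.1's level-wise edge separation consumes;
Consumers working with the canonical presentation `BObj.coveringHomCan` transport along
`coveringHomCan_eq_coveringHom` (the binder types mention `φ_{ṽ₁}` at the base vertex `v`, so the
statement is given for the definitional presentation `BObj.coveringHom`).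

Method: the vertex factorisation and the tautological point of `CoveringOfObjectVertexAligned.lean`
(abc-iut's proof that `𝒢_A → 𝒢` is vertex aligned), branch alignment of `𝒢_A → 𝒢`
(`map_branchSubgroup_eq_inf_of_aligned`, `coveringHom_isBranchAligned`) for the frame
`(φ_ẽ^* ⋙ F_Q, alignIso)`, an explicit-conjugator form of `map_range_pi1Map_autMulEquivOfIso`, and the
edge tautological point of `LevelBranchDiagonal.lean` for the pinning.  No statement here takes a
side on any disputed claim; nothing about [IUTchIII] Cor. 3.12.
-/

namespace Literature.AnabelianGeometry.SemiGraphs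

open CategoryTheory CategoryTheory.Limits CategoryTheory.Functor CategoryTheory.PreGaloisCategory
open Literature.AnabelianGeometry.Anabelioids
open scoped Pointwise

universe v₁ u₁ u

/-! ### A. Generic bookkeeping -/

section Generic

variable {B : Type*} [Category B] {C : Type*} [Category C]

set_option backward.isDefEq.respectTransparency false

/-- The image under `π₁(R)` of a point stabiliser intersected with a subgroup `H` is the stabiliser of
the image point intersected with the image of `H` (for a morphism `m : X ⟶ R A` sent to an injection).
[cite: MochizukiSemiAnbd2006, Rem. 2.2.1 p.24] -/
theorem map_stabilizer_inf_pi1Map_eq (R : B ⥤ C) (G : C ⥤ FintypeCat.{v₁}) {X : C} {A : B}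
    (m : X ⟶ R.obj A) (hm : Function.Injective (G.map m)) (p : G.obj X) (H : Subgroup (Aut G)) :
    (MulAction.stabilizer (Aut G) p ⊓ H).map (pi1Map R G) =
      @MulAction.stabilizer (Aut (R ⋙ G)) ((R ⋙ G).obj A) _ _ (G.map m p) ⊓ H.map (pi1Map R G) := by
  ext g
  simp only [Subgroup.mem_map, Subgroup.mem_inf, MulAction.mem_stabilizer_iff, mulAction_def]
  constructor
  · rintro ⟨h, ⟨hh, hH⟩, rfl⟩
    refine ⟨?_, ⟨h, hH, rfl⟩⟩
    change h.hom.app (R.obj A) (G.map m p) = G.map m p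
    rw [FunctorToFintypeCat.naturality, hh]
  · rintro ⟨hg, ⟨h, hH, rfl⟩⟩
    refine ⟨h, ⟨?_, hH⟩, rfl⟩
    change h.hom.app (R.obj A) (G.map m p) = G.map m p at hg
    rw [FunctorToFintypeCat.naturality] at hg
    exact hm hg

/-- EXPLICIT form of `map_range_pi1Map_autMulEquivOfIso`: conjugation by an isomorphism
`β : R ⋙ G₁ ≅ R ⋙ G₂` of induced basepoints carries the range of `π₁(R)_{G₁}` to `g⁻¹ (range π₁(R)_{G₂}) g`
for THE element `g := β⁻¹ ≫ R γ ∈ Aut (R ⋙ G₂)`, `γ : G₁ ≅ G₂` any isomorphism of basepoints of `C`.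
[cite: MochizukiSemiAnbd2006, Rem. 2.2.1 p.24] -/
theorem map_range_pi1Map_autMulEquivOfIso_explicit (R : B ⥤ C) {G₁ G₂ : C ⥤ FintypeCat.{v₁}}
    (γ : G₁ ≅ G₂) (β : R ⋙ G₁ ≅ R ⋙ G₂) :
    (pi1Map R G₁).range.map (Aut.autMulEquivOfIso β).toMonoidHom =
      ConjAct.toConjAct (show Aut (R ⋙ G₂) from β.symm ≪≫ isoWhiskerLeft R γ)⁻¹ •
        (pi1Map R G₂).range := by
  set g : Aut (R ⋙ G₂) := β.symm ≪≫ isoWhiskerLeft R γ with hg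
  have key' : ∀ x : Aut (R ⋙ G₁), Aut.autMulEquivOfIso β x =
      g⁻¹ * Aut.autMulEquivOfIso (isoWhiskerLeft R γ) x * g⁻¹⁻¹ := by
    intro x
    apply Iso.ext
    rw [inv_inv, autMulEquivOfIso_hom, aut_mul_hom, aut_mul_hom, aut_inv_hom, autMulEquivOfIso_hom, hg]
    simp only [Iso.trans_hom, Iso.trans_inv, Iso.symm_hom, Iso.symm_inv, Category.assoc,
      Iso.hom_inv_id_assoc]
  have key : ∀ z : Aut G₁, Aut.autMulEquivOfIso β (pi1Map R G₁ z) =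
      g⁻¹ * pi1Map R G₂ (Aut.autMulEquivOfIso γ z) * g⁻¹⁻¹ := by
    intro z
    rw [key', autMulEquivOfIso_whiskerLeft_pi1Map]
  ext y
  simp only [Subgroup.mem_map, MonoidHom.mem_range, MulEquiv.coe_toMonoidHom,
    Subgroup.mem_smul_pointwise_iff_exists, ConjAct.smul_def, ConjAct.ofConjAct_toConjAct,
    exists_exists_eq_and]
  constructor
  · rintro ⟨z, rfl⟩
    exact ⟨Aut.autMulEquivOfIso γ z, (key z).symm⟩
  · rintro ⟨w, rfl⟩
    refine ⟨(Aut.autMulEquivOfIso γ).symm w, ?_⟩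
    rw [key, MulEquiv.apply_symm_apply]

/-- `Aut(a ≫ b) = Aut(b) ∘ Aut(a)` as monoid homomorphisms. [cite: MochizukiGeoAn2004, Def. 1.1.2(ii) p.10] -/
theorem autMulEquivOfIso_trans_toMonoidHom {D : Type*} [Category D] {X Y Z : D} (a : X ≅ Y) (b : Y ≅ Z) :
    (Aut.autMulEquivOfIso (a ≪≫ b)).toMonoidHom =
      (Aut.autMulEquivOfIso b).toMonoidHom.comp (Aut.autMulEquivOfIso a).toMonoidHom :=
  MonoidHom.ext fun y => autMulEquivOfIso_trans a b y

end Generic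

/-! ### B. The dictionary with its pinning, for `𝒢_A → 𝒢` -/

namespace SemiGraphOfAnabelioids

namespace BObj

variable {𝒢 : SemiGraphOfAnabelioids.{v₁, u₁, u}} (A : 𝒢.BObj)

set_option backward.isDefEq.respectTransparency false

/-- **Level branch groups in `Π_𝒢`-coordinates, with pinning** (see the module docstring): for the
covering `𝒢_A → 𝒢`, a base level vertex `ṽ₁ = (v, P₁)` (basepoints `F′`, `F`, identification `e`,
`t₁` the point of the one-point fibre `F′(P₁ = P₁)`), a level branch `(b, Q)` abutting to `(v, P)`
with basepoints `F″`, `F_Q` and transports `α̃ : (b,Q)^* ⋙ F_Q ≅ F″`, `α : ρ̃_{(v,P)} ⋙ F″ ≅ ρ̃_{ṽ₁} ⋙ F′`,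
and a reference edge basepoint `F_e` of `𝒢_e` with `α_e : b^* ⋙ F_e ≅ F`: there is `γ ∈ Π_𝒢` with
`ι(conj_α(Π_{(b,Q)} → Π_{(v,P)} → Π_{𝒢_A})) = Stab_{Π_𝒢}(x₀) ∩ γ Π_b^{F_e,α_e} γ⁻¹` and
`F_e(ψ_b)(α_e⁻¹(γ⁻¹ x₀)) ∈ F_e(Q)`, `x₀ = e(a′)` the tautological point.
[cite: MochizukiSemiAnbd2006, Def. 2.2(i) p.23, Rem. 2.2.1 p.24] -/
theorem coveringHom_levelBranch_dictionary (v₀ : 𝒢.graph.Vertex) (c₁ c₂ : A.fibreData.FV v₀)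
    (F' : A.coveringGraph.V (⟨v₀, c₁⟩ : A.fibreData.total.Vertex) ⥤ FintypeCat.{v₁}) [FiberFunctor F']
    (F : 𝒢.V v₀ ⥤ FintypeCat.{v₁}) [FiberFunctor F]
    (e : (A.coveringHom.φV (⟨v₀, c₁⟩ : A.fibreData.total.Vertex)).pullback ⋙ F' ≅ F)
    (t₁ : F'.obj ((Shrink.equivalence (Over ((A.vComp (⟨v₀, c₁⟩ : A.fibreData.total.Vertex)).1 :
      𝒢.V (A.fibreData.proj.vertexMap (⟨v₀, c₁⟩ : A.fibreData.total.Vertex))))).functor.obj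
      (Over.mk (𝟙 ((A.vComp (⟨v₀, c₁⟩ : A.fibreData.total.Vertex)).1 :
        𝒢.V (A.fibreData.proj.vertexMap (⟨v₀, c₁⟩ : A.fibreData.total.Vertex)))))))
    (b : 𝒢.graph.Branch) (cQ : A.fibreData.FE (𝒢.graph.edgeOf b))
    (hb : A.coveringGraph.graph.abuts (⟨b, cQ⟩ : A.fibreData.total.Branch) =
      some (⟨v₀, c₂⟩ : A.fibreData.total.Vertex))
    (F'' : A.coveringGraph.V (⟨v₀, c₂⟩ : A.fibreData.total.Vertex) ⥤ FintypeCat.{v₁}) [FiberFunctor F'']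
    (Fe'' : A.coveringGraph.E (A.coveringGraph.graph.edgeOf (⟨b, cQ⟩ : A.fibreData.total.Branch)) ⥤
      FintypeCat.{v₁}) [FiberFunctor Fe'']
    (αt : (A.coveringGraph.pull (⟨b, cQ⟩ : A.fibreData.total.Branch) ⟨v₀, c₂⟩ hb).pullback ⋙ Fe'' ≅ F'')
    (α : A.coveringGraph.ρ (⟨v₀, c₂⟩ : A.fibreData.total.Vertex) ⋙ F'' ≅
      A.coveringGraph.ρ (⟨v₀, c₁⟩ : A.fibreData.total.Vertex) ⋙ F')
    (h₀ : 𝒢.graph.abuts b = some v₀)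
    (Fe : 𝒢.E (𝒢.graph.edgeOf b) ⥤ FintypeCat.{v₁}) [FiberFunctor Fe]
    (αe : (𝒢.pull b v₀ h₀).pullback ⋙ Fe ≅ F) :
    ∃ γ : 𝒢.Pi v₀ F,
      (((A.coveringGraph.branchSubgroup F'' (⟨b, cQ⟩ : A.fibreData.total.Branch) hb Fe'' αt).map
            (A.coveringGraph.piVToPi (⟨v₀, c₂⟩ : A.fibreData.total.Vertex) F'')).map
          (Aut.autMulEquivOfIso α).toMonoidHom).map
        ((Aut.autMulEquivOfIso (isoWhiskerLeft (𝒢.ρ v₀) e)).toMonoidHom.comp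
          (pi1Map A.coveringHom.pullbackFunctor
            (A.coveringGraph.ρ (⟨v₀, c₁⟩ : A.fibreData.total.Vertex) ⋙ F'))) =
        MulAction.stabilizer (𝒢.Pi v₀ F)
            (show (𝒢.ρ v₀ ⋙ F).obj A from
              e.hom.app (A.S v₀)
                (F'.map ((Shrink.equivalence (Over ((A.vComp (⟨v₀, c₁⟩ : A.fibreData.total.Vertex)).1 :
                    𝒢.V (A.fibreData.proj.vertexMap (⟨v₀, c₁⟩ : A.fibreData.total.Vertex))))).functor.map
                  ((Over.forgetAdjStar ((A.vComp (⟨v₀, c₁⟩ : A.fibreData.total.Vertex)).1 :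
                      𝒢.V (A.fibreData.proj.vertexMap (⟨v₀, c₁⟩ : A.fibreData.total.Vertex)))).unit.app
                      (Over.mk (𝟙 _)) ≫
                    (Over.star ((A.vComp (⟨v₀, c₁⟩ : A.fibreData.total.Vertex)).1 :
                      𝒢.V (A.fibreData.proj.vertexMap (⟨v₀, c₁⟩ : A.fibreData.total.Vertex)))).map
                      (A.vComp (⟨v₀, c₁⟩ : A.fibreData.total.Vertex)).1.arrow)) t₁)) ⊓
          ConjAct.toConjAct γ • ((𝒢.branchSubgroup F b h₀ Fe αe).map (𝒢.piVToPi v₀ F)) ∧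
      Fe.map (A.ψ b v₀ h₀).hom (αe.inv.app (A.S v₀)
          (γ⁻¹ • (show (𝒢.ρ v₀ ⋙ F).obj A from
              e.hom.app (A.S v₀)
                (F'.map ((Shrink.equivalence (Over ((A.vComp (⟨v₀, c₁⟩ : A.fibreData.total.Vertex)).1 :
                    𝒢.V (A.fibreData.proj.vertexMap (⟨v₀, c₁⟩ : A.fibreData.total.Vertex))))).functor.map
                  ((Over.forgetAdjStar ((A.vComp (⟨v₀, c₁⟩ : A.fibreData.total.Vertex)).1 :
                      𝒢.V (A.fibreData.proj.vertexMap (⟨v₀, c₁⟩ : A.fibreData.total.Vertex)))).unit.app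
                      (Over.mk (𝟙 _)) ≫
                    (Over.star ((A.vComp (⟨v₀, c₁⟩ : A.fibreData.total.Vertex)).1 :
                      𝒢.V (A.fibreData.proj.vertexMap (⟨v₀, c₁⟩ : A.fibreData.total.Vertex)))).map
                      (A.vComp (⟨v₀, c₁⟩ : A.fibreData.total.Vertex)).1.arrow)) t₁)))) ∈
        Set.range (Fe.map (A.brComp (⟨b, cQ⟩ : A.fibreData.total.Branch)).1.arrow) := by
  -- notation
  let v₁ : A.fibreData.total.Vertex := ⟨v₀, c₁⟩
  let v₂ : A.fibreData.total.Vertex := ⟨v₀, c₂⟩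
  let bc : A.fibreData.total.Branch := ⟨b, cQ⟩
  let ec : A.fibreData.total.Edge := A.coveringGraph.graph.edgeOf bc
  let P₂ : Subobject (A.S v₀) := (A.vComp v₂).1
  let Q : Subobject (A.T (𝒢.graph.edgeOf b)) := (A.brComp bc).1
  let eP₂ := Shrink.equivalence (Over (P₂ : 𝒢.V v₀))
  haveI : GaloisCategory (Shrink.{u₁} (Over ((A.vComp v₂).1 : 𝒢.V (A.fibreData.proj.vertexMap v₂)))) :=
    A.galoisCategory_vModel v₂
  haveI : GaloisCategory (Shrink.{u₁} (Over ((A.eComp ec).1 : 𝒢.E (A.fibreData.proj.edgeMap ec)))) :=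
    A.galoisCategory_eModel ec
  -- `F₂ := φ_ṽ^* ⋙ F″` (a basepoint of `𝒢_v`) and `Fe₂ := φ_ẽ^* ⋙ F_Q` (a basepoint of `𝒢_e`)
  haveI : PreservesFiniteLimits (A.coveringHom.φV v₂).pullback := (A.coveringHom.φV v₂).property.1
  haveI : PreservesFiniteColimits (A.coveringHom.φV v₂).pullback := (A.coveringHom.φV v₂).property.2
  haveI : FiberFunctor ((A.coveringHom.φV v₂).pullback ⋙ F'') :=
    fiberFunctor_comp_of_exact (A.coveringHom.φV v₂).pullback F''
  let F₂ : 𝒢.V v₀ ⥤ FintypeCat.{v₁} := (A.coveringHom.φV v₂).pullback ⋙ F''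
  have hidx : A.coveringHom.base.edgeMap (A.coveringGraph.graph.edgeOf bc) = 𝒢.graph.edgeOf b := rfl
  haveI : PreservesFiniteLimits (A.coveringHom.φE ec (𝒢.graph.edgeOf b) hidx).pullback :=
    (A.coveringHom.φE ec _ hidx).property.1
  haveI : PreservesFiniteColimits (A.coveringHom.φE ec (𝒢.graph.edgeOf b) hidx).pullback :=
    (A.coveringHom.φE ec _ hidx).property.2
  haveI : FiberFunctor ((A.coveringHom.φE ec (𝒢.graph.edgeOf b) hidx).pullback ⋙ Fe'') :=
    fiberFunctor_comp_of_exact _ Fe''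
  let Fe₂ : 𝒢.E (𝒢.graph.edgeOf b) ⥤ FintypeCat.{v₁} := (A.coveringHom.φE ec (𝒢.graph.edgeOf b) hidx).pullback ⋙ Fe''
  -- the points of the one-point fibres and an isomorphism `δ : Fe₂ ≅ F_e` of edge basepoints
  obtain ⟨t₂⟩ := A.nonempty_fiber_mkId v₂ F''
  obtain ⟨tE⟩ := A.nonempty_fiber_mkId_E ec Fe''
  obtain ⟨δ⟩ := nonempty_iso_of_fiberFunctor Fe₂ Fe
  -- the two transports into `K := ρ_v ⋙ F`: `β_v := e ∘ φ^* α` and the frames `θ₁`, `θ₂`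
  let β : 𝒢.ρ v₀ ⋙ F₂ ≅ 𝒢.ρ v₀ ⋙ F :=
    isoWhiskerLeft A.coveringHom.pullbackFunctor α ≪≫ isoWhiskerLeft (𝒢.ρ v₀) e
  let T₂ : (𝒢.pull b v₀ h₀).pullback ⋙ Fe₂ ≅ F₂ :=
    A.coveringHom.alignIso bc v₂ hb b rfl F'' Fe'' αt ≪≫ Iso.refl _
  let R : 𝒢.BObj ⥤ 𝒢.E (𝒢.graph.edgeOf b) := 𝒢.ρ v₀ ⋙ (𝒢.pull b v₀ h₀).pullback
  let θ₁ : R ⋙ Fe₂ ≅ 𝒢.ρ v₀ ⋙ F := isoWhiskerLeft (𝒢.ρ v₀) T₂ ≪≫ β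
  let θ₂ : R ⋙ Fe ≅ 𝒢.ρ v₀ ⋙ F := isoWhiskerLeft (𝒢.ρ v₀) αe
  let g : Aut (R ⋙ Fe) := (θ₁ ≪≫ θ₂.symm).symm ≪≫ isoWhiskerLeft R δ
  -- A1. factorisation of `ι ∘ conj_α ∘ (Π_ṽ → Π_{𝒢_A})` through `Aut F₂` (as in vertex alignment (b))
  have hfac : (((Aut.autMulEquivOfIso (isoWhiskerLeft (𝒢.ρ v₀) e)).toMonoidHom.comp
          (pi1Map A.coveringHom.pullbackFunctor (A.coveringGraph.ρ v₁ ⋙ F'))).comp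
        (Aut.autMulEquivOfIso α).toMonoidHom).comp (A.coveringGraph.piVToPi v₂ F'') =
      ((Aut.autMulEquivOfIso β).toMonoidHom.comp (𝒢.piVToPi v₀ F₂)).comp
        ((Aut.autMulEquivOfIso (Iso.refl F₂)).toMonoidHom.comp
          (pi1Map (A.coveringHom.φV v₂).pullback F'')) := by
    refine MonoidHom.ext fun x => ?_
    have h1 : pi1Map A.coveringHom.pullbackFunctor (A.coveringGraph.ρ v₂ ⋙ F'')
        (A.coveringGraph.piVToPi v₂ F'' x) =
        𝒢.piVToPi v₀ F₂ (pi1Map (A.coveringHom.φV v₂).pullback F'' x) :=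
      Iso.ext (NatTrans.ext (funext fun X => rfl))
    change Aut.autMulEquivOfIso (isoWhiskerLeft (𝒢.ρ v₀) e)
        (pi1Map A.coveringHom.pullbackFunctor (A.coveringGraph.ρ v₁ ⋙ F')
          (Aut.autMulEquivOfIso α (A.coveringGraph.piVToPi v₂ F'' x))) =
      Aut.autMulEquivOfIso β (𝒢.piVToPi v₀ F₂
        (Aut.autMulEquivOfIso (Iso.refl F₂) (pi1Map (A.coveringHom.φV v₂).pullback F'' x)))
    rw [autMulEquivOfIso_refl, ← autMulEquivOfIso_whiskerLeft_pi1Map, h1]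
    exact (autMulEquivOfIso_trans _ _ _).symm
  -- A2. branch alignment of `𝒢_A → 𝒢` at the level branch, in the frame `(Fe₂, T₂)`
  have halign := map_branchSubgroup_eq_inf_of_aligned A.coveringHom A.coveringHom_isBranchAligned
    v₂ F'' b bc hb rfl Fe'' αt (Iso.refl F₂) h₀
  -- A3. the local half at `ṽ` (L6-t17): `range (π₁(φ_ṽ)) = Stab(p₂)`, and its tautological point
  have hloc₂ := range_pi1Map_eq_stabilizer (S := (P₂ : 𝒢.V v₀)) eP₂.functor
    (Q := (A.coveringHom.φV v₂).pullback) (Iso.refl _) F'' (Iso.refl _) t₂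
  have hinj₂ : Function.Injective (F₂.map P₂.arrow) :=
    ConcreteCategory.injective_of_mono_of_preservesPullback _
  have hpt₂ := A.map_arrow_basePoint v₂ F'' F₂ (Iso.refl _) t₂
  -- A4. the tautological point is carried from `ṽ` to `ṽ₁` by `α` (diagonal endomorphism)
  obtain ⟨d, hd⟩ := A.exists_pullbackObj_diagEndo
  have hα := FunctorToFintypeCat.naturality (A.coveringGraph.ρ v₂ ⋙ F'') (A.coveringGraph.ρ v₁ ⋙ F')
    α.hom d
    (F''.map (eP₂.functor.map
      ((Over.forgetAdjStar (P₂ : 𝒢.V v₀)).unit.app (Over.mk (𝟙 _)) ≫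
        (Over.star (P₂ : 𝒢.V v₀)).map P₂.arrow)) t₂)
  change α.hom.app (A.coveringHom.pullbackFunctor.obj A) (F''.map (d.fS v₂) _) =
    F'.map (d.fS v₁) (α.hom.app (A.coveringHom.pullbackFunctor.obj A) _) at hα
  rw [A.map_diagEndo_fS_apply d hd v₂ F'' t₂, A.map_diagEndo_fS_apply d hd v₁ F' t₁] at hα
  have hbpt := congrArg (fun y => e.hom.app (A.S v₀) y)
    ((congrArg (fun y => α.hom.app (A.coveringHom.pullbackFunctor.obj A) y) hpt₂).trans hα)
  -- A5. the frames in `Π_𝒢 = Aut (ρ_v ⋙ F)`: `piVToPi ∘ conj_T ∘ π₁(b^*) = conj_{ρ ◁ T} ∘ π₁(ρ ⋙ b^*)`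
  have hR₂ : (𝒢.piVToPi v₀ F₂).comp ((Aut.autMulEquivOfIso T₂).toMonoidHom.comp
        (𝒢.piBToPiV b v₀ h₀ Fe₂)) =
      (Aut.autMulEquivOfIso (isoWhiskerLeft (𝒢.ρ v₀) T₂)).toMonoidHom.comp (pi1Map R Fe₂) := by
    refine MonoidHom.ext fun σ => ?_
    change 𝒢.piVToPi v₀ F₂ (Aut.autMulEquivOfIso T₂ (𝒢.piBToPiV b v₀ h₀ Fe₂ σ)) =
      Aut.autMulEquivOfIso (isoWhiskerLeft (𝒢.ρ v₀) T₂) (pi1Map R Fe₂ σ)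
    rw [← autMulEquivOfIso_whiskerLeft_pi1Map]
    exact congrArg _ (Iso.ext (NatTrans.ext (funext fun X => rfl)))
  have hRe : (𝒢.piVToPi v₀ F).comp ((Aut.autMulEquivOfIso αe).toMonoidHom.comp
        (𝒢.piBToPiV b v₀ h₀ Fe)) =
      (Aut.autMulEquivOfIso θ₂).toMonoidHom.comp (pi1Map R Fe) := by
    refine MonoidHom.ext fun σ => ?_
    change 𝒢.piVToPi v₀ F (Aut.autMulEquivOfIso αe (𝒢.piBToPiV b v₀ h₀ Fe σ)) =
      Aut.autMulEquivOfIso θ₂ (pi1Map R Fe σ)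
    rw [← autMulEquivOfIso_whiskerLeft_pi1Map]
    exact congrArg _ (Iso.ext (NatTrans.ext (funext fun X => rfl)))
  have hAb : (𝒢.branchSubgroup F b h₀ Fe αe).map (𝒢.piVToPi v₀ F) =
      (pi1Map R Fe).range.map (Aut.autMulEquivOfIso θ₂).toMonoidHom := by
    rw [branchSubgroup, ← MonoidHom.range_comp, hRe, MonoidHom.range_comp]
  have hBfr : ((𝒢.branchSubgroup F₂ b h₀ Fe₂ T₂).map (𝒢.piVToPi v₀ F₂)).map
        (Aut.autMulEquivOfIso β).toMonoidHom =
      (pi1Map R Fe₂).range.map (Aut.autMulEquivOfIso θ₁).toMonoidHom := by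
    rw [branchSubgroup, ← MonoidHom.range_comp, hR₂, MonoidHom.range_comp, Subgroup.map_map,
      ← autMulEquivOfIso_trans_toMonoidHom]
  -- A6. explicit transport between the two frames
  have hθ : (Aut.autMulEquivOfIso θ₁).toMonoidHom =
      (Aut.autMulEquivOfIso θ₂).toMonoidHom.comp (Aut.autMulEquivOfIso (θ₁ ≪≫ θ₂.symm)).toMonoidHom := by
    rw [← autMulEquivOfIso_trans_toMonoidHom, Iso.trans_assoc, Iso.symm_self_id, Iso.trans_refl]
  have hexp := map_range_pi1Map_autMulEquivOfIso_explicit R δ (θ₁ ≪≫ θ₂.symm)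
  refine ⟨(Aut.autMulEquivOfIso θ₂ g)⁻¹, ?_, ?_⟩
  · -- the subgroup identity
    rw [Subgroup.map_map, Subgroup.map_map, hfac, ← Subgroup.map_map, halign, hloc₂,
      ← Subgroup.map_map,
      map_stabilizer_inf_pi1Map_eq (𝒢.ρ v₀) F₂ (A := A) P₂.arrow hinj₂,
      Subgroup.map_inf _ _ _ (Aut.autMulEquivOfIso β).injective,
      map_stabilizer_autMulEquivOfIso β, hBfr, hθ, ← Subgroup.map_map, hexp,
      Literature.AnabelianGeometry.SemiGraphs.map_conjAct_smul, ← hAb, MulEquiv.coe_toMonoidHom,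
      _root_.map_inv]
    congr 2
  · -- the pinning clause
    -- B1. the acting element: `conj_{θ₂}(g) = θ₁⁻¹ ≫ (R ◁ δ) ≫ θ₂`
    have hg : (Aut.autMulEquivOfIso θ₂ g).hom.app A =
        β.inv.app A ≫ T₂.inv.app (A.S v₀) ≫ δ.hom.app (R.obj A) ≫ αe.hom.app (A.S v₀) := by
      simp only [g, θ₁, θ₂, autMulEquivOfIso_hom, Iso.trans_hom, Iso.symm_hom,
        Iso.trans_symm, Iso.symm_symm_eq, isoWhiskerLeft_hom, isoWhiskerLeft_inv,
        NatTrans.comp_app, whiskerLeft_app, Category.assoc, Iso.inv_hom_id_app_assoc]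
      rfl
    -- B2. `β⁻¹(x₀) = a″`, the tautological point at `ṽ`
    have hβinv : β.inv.app A (e.hom.app (A.S v₀)
          (F'.map ((Shrink.equivalence (Over ((A.vComp v₁).1 : 𝒢.V (A.fibreData.proj.vertexMap v₁)))).functor.map
            ((Over.forgetAdjStar ((A.vComp v₁).1 : 𝒢.V (A.fibreData.proj.vertexMap v₁))).unit.app (Over.mk (𝟙 _)) ≫
              (Over.star ((A.vComp v₁).1 : 𝒢.V (A.fibreData.proj.vertexMap v₁))).map (A.vComp v₁).1.arrow)) t₁)) =
        F''.map ((Shrink.equivalence (Over ((A.vComp v₂).1 : 𝒢.V (A.fibreData.proj.vertexMap v₂)))).functor.map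
          ((Over.forgetAdjStar ((A.vComp v₂).1 : 𝒢.V (A.fibreData.proj.vertexMap v₂))).unit.app (Over.mk (𝟙 _)) ≫
            (Over.star ((A.vComp v₂).1 : 𝒢.V (A.fibreData.proj.vertexMap v₂))).map (A.vComp v₂).1.arrow)) t₂ := by
      have h1 : β.hom.app A (F''.map ((Shrink.equivalence (Over ((A.vComp v₂).1 :
            𝒢.V (A.fibreData.proj.vertexMap v₂)))).functor.map
          ((Over.forgetAdjStar ((A.vComp v₂).1 : 𝒢.V (A.fibreData.proj.vertexMap v₂))).unit.app (Over.mk (𝟙 _)) ≫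
            (Over.star ((A.vComp v₂).1 : 𝒢.V (A.fibreData.proj.vertexMap v₂))).map (A.vComp v₂).1.arrow)) t₂) =
          e.hom.app (A.S v₀)
            (F'.map ((Shrink.equivalence (Over ((A.vComp v₁).1 : 𝒢.V (A.fibreData.proj.vertexMap v₁)))).functor.map
              ((Over.forgetAdjStar ((A.vComp v₁).1 : 𝒢.V (A.fibreData.proj.vertexMap v₁))).unit.app (Over.mk (𝟙 _)) ≫
                (Over.star ((A.vComp v₁).1 : 𝒢.V (A.fibreData.proj.vertexMap v₁))).map (A.vComp v₁).1.arrow)) t₁) := by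
        rw [← hα]; rfl
      rw [← h1]
      exact FintypeCat.hom_inv_id_apply (β.app A) _
    -- B3. the frame transport `T₂⁻¹` at `S_v`: `α̃⁻¹` followed by the 2-cell `φ_b̃`
    have hT : T₂.inv.app (A.S v₀) =
        αt.inv.app ((A.coveringHom.φV v₂).pullback.obj (A.S v₀)) ≫
          Fe''.map ((A.coveringHom.φB bc v₂ hb).hom.app (A.S v₀)) := by
      simp only [T₂, Hom.alignIso, Iso.trans_inv, Iso.refl_inv, Iso.symm_inv, isoWhiskerRight_hom,
        isoWhiskerLeft_inv, NatTrans.comp_app, whiskerRight_app, whiskerLeft_app]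
      rfl
    -- B4. the gluing isomorphism `ψ̃_{b̃}` of `φ^* A` is `φ_b̃` followed by `φ_ẽ^*(ψ_b)`
    have hψ : ((A.coveringHom.pullbackFunctor.obj A).ψ bc v₂ hb).hom =
        (A.coveringHom.φB bc v₂ hb).hom.app (A.S v₀) ≫
          (A.coveringHom.φE ec (𝒢.graph.edgeOf b) hidx).pullback.map (A.ψ b v₀ h₀).hom := by
      have h1 : ((A.coveringHom.pullbackFunctor.obj A).ψ bc v₂ hb).hom =
          (A.coveringHom.φB bc v₂ hb).hom.app (A.S v₀) ≫
            (A.coveringHom.φE _ _ (A.fibreData.proj.edgeOf_branchMap bc).symm).pullback.map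
              (A.ψ b v₀ (A.fibreData.proj.abuts_branchMap bc v₂ hb)).hom ≫
            (A.coveringHom.reindexIso (A.fibreData.total.edgeOf bc) _ _
              (A.fibreData.proj.edgeOf_branchMap bc).symm rfl).hom.app A := rfl
      have h2 : (A.coveringHom.reindexIso (A.fibreData.total.edgeOf bc) _ _
          (A.fibreData.proj.edgeOf_branchMap bc).symm rfl).hom.app A = 𝟙 _ := by
        simp [Hom.reindexIso]
      rw [h1, h2]
      erw [Category.comp_id]
      rfl
    -- B5. hence the transported point is the EDGE tautological point `a‴` …
    have hw := A.map_ψ_diagPoint bc v₂ hb F'' Fe'' αt t₂ tE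
    rw [hψ, Fe''.map_comp, FintypeCat.comp_apply] at hw
    -- … which lies in `Fe₂(Q)`
    obtain ⟨q, hq⟩ := A.diagPointE_mem_range ec Fe'' tE
    have hq' : Fe₂.map (A.brComp (⟨b, cQ⟩ : A.fibreData.total.Branch)).1.arrow q = _ := hq
    -- B6. assemble, transporting along `δ : Fe₂ ≅ F_e`
    rw [inv_inv, mulAction_def, hg, FintypeCat.comp_apply, FintypeCat.comp_apply, FintypeCat.comp_apply]
    erw [FintypeCat.hom_inv_id_apply (αe.app (A.S v₀))]
    rw [hβinv, hT, FintypeCat.comp_apply]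
    refine ⟨δ.hom.app _ q, ?_⟩
    rw [← FunctorToFintypeCat.naturality Fe₂ Fe δ.hom, hq']
    exact (congrArg (δ.hom.app _) hw.symm).trans
      (FunctorToFintypeCat.naturality Fe₂ Fe δ.hom (A.ψ b v₀ h₀).hom _)

end BObj

end SemiGraphOfAnabelioids

end Literature.AnabelianGeometry.SemiGraphs
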